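import Summits.ABC.IUTFork.Joshi.LogLinkWittShiftedRing
import Summits.ABC.IUTFork.Joshi.PrototypeWittModel
import Summits.ABC.IUTFork.Joshi.TeichmullerInvariantSurjection
import HarnessLib

/-!
# W6⁺ — the SHIFTED Witt ring over E-t50's W6 datum: `EtaPtTeich` ∧ bijective `ϕ` ∧ the Witt law `ϕ([a]) = [a^p]` ∧ §10.13 transports
# on ALL of `classicalPts` (and at no junk fixed point) ∧ `B^{φ=p} ≠ 0` ∧ «log hits 1» ∧ p430819's (R-ϕ) horn at EVERY classical class,
# at ONE datum of E-t3's signature — a model exhibits satisfiability of TYPED hypotheses, nothing more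

Test-side support file of the abc-iut cell, block E «type Joshi's construction, test vs S» (rung LADDER-ABC:A2.E; seat abc-iut-E-t52 gen 4,
the `TeichFrobModel` lineage). INSTANCE of this seat's generic layer `WittShift` (`Joshi/LogLinkWittShiftedRing.lean`, p453359) at E-t50 g5's
W6 datum `JointModel.Witt.periodRingDatum Λ` (`Joshi/PrototypeWittModel.lean` p450964, values `Joshi/PrototypeWittModelValues.lean` p450559),
which E-t50 built on a polynomial ring with FIXED coefficients (`B^{φ=p} = 0` there, so p430819's horn Props are degenerate-shaped at it) and
whose eigen-upgrade E-t50 13:31:38Z left to this seat. Everything BY NAME, nothing restated: the base datum's points `Y = Q̄_p/∼` (p441701),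
value maps `L_w` with `value_frobPerm` / `value_diag`, orbit index `orbitIdx` with `orbitIdx_frobPerm`, `etaPtTeich`; the layer's `datum` /
`transport` / `rphi_horn` / `scale_frobY_and_absK` / `etaPtTeich_iff`; p447117's `isEmpty_frobeniusTransport_pt_one`; the `ClassLift`
inhabitant from this seat's `Model.invLift` (p451035; public version = E-t50's `invClassLift`, part 3 p452268). Source of the hypotheses: K. Joshi, arXiv:2303.01662v3 §6.6, §6.10, §10.5,
§10.13–§10.15 (`paper:arxiv-2303.01662`, bib `Joshi2023ATS2Local`, UNREFEREED — typed AS A CANDIDATE by E-t3/E-t7/E-t2; nothing of it asserted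
here). TAKES NO SIDE on [IUTchIII] Cor. 3.12, on Joshi's claims, or on Mochizuki's reports on them; typed ≠ proved ≠ endorsed.

THE DATUM `W6.datum Λ := WittShift.datum (JointModel.Witt.periodRingDatum Λ) (−orbitIdx)`: E-t50's points, absolute values, `pt`, `ϕ_Y`,
scales and Teichmüller VALUES `L_w`, on the ring `MvPolynomial Q̄_p (ℤ → Q̄_p)` with `ϕ := rename (·^p) ∘ map shift` and `η_w := eval₂
ev_{−n(w)} L_w`. The layer's two per-point hypotheses hold at every CLASSICAL class `w` (`e(w) > 0`): (H1) `L_{ϕw}(x^p) = L_w(x)` is E-t50's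
`value_frobPerm` read through `eval_X` (`values_frob`); (H2) `−n(ϕw) + 1 = −n(w)` is `orbitIdx_frobPerm` (`idx_step`).
RESULTS: `transport hw` at every classical class; **`w6plus_package`** (parametric in `Λ : ClassLift p`): `EtaPtTeich` ∧ `ϕ_Y` bijective ∧
Witt law ∧ transports on `classicalPts` ∧ NO transport at `pt 1` ∧ `KummerShift` ∧ `B^{φ=p} ≠ 0` ∧ at every classical class «log hits 1»,
`¬NoCommutingFieldIso`, `¬NoInsertedIso`, `LogShellStep`, `¬LogsCoincide` (identity common target) ∧ `scale(ϕw) = p·scale(w)`; the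
(private) `ClassLift` inhabitant `Λ(w) := invLift (w.out)` (p451035; public twin = E-t50's `invClassLift`, p452268) and **`w6plus_nonvacuous`**
at every prime `p`.
Logical model (`G = Unit`, `T_y = {0}`, norm reads variables only), not arithmetic-faithful; continuity unmodelled. [folklore] model-building;
no claim about Joshi's or Mochizuki's mathematics is made or implied.
-/

noncomputable section

open MvPolynomial

namespace Summit.ABC.IUTFork.Joshi.WittShift.W6

variable {p : ℕ} [hp : Fact p.Prime] (Λ : JointModel.Witt.ClassLift p)

/-- E-t50's W6 period-ring datum (p450964), the BASE of the instance. [folklore] -/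
abbrev base : PeriodRingDatum (PadicAlgCl p) (JointModel.Witt.Ring p) (PadicAlgCl p) (JointModel.Pt p) (fun _ => PadicAlgCl p) Unit :=
  JointModel.Witt.periodRingDatum Λ

variable (p) in
/-- The coefficient index `ι(w) := −n(w)` (E-t50's orbit index `orbitIdx`, negated so that `ι(ϕw) + 1 = ι(w)`). [folklore] -/
def idx (w : JointModel.Pt p) : ℤ := -JointModel.Witt.orbitIdx p w

/-- **The W6⁺ datum**: the shifted Witt ring over E-t50's W6 datum. [folklore] -/
abbrev datum : PeriodRingDatum (PadicAlgCl p) (WittShift.Ring (PadicAlgCl p) (PadicAlgCl p)) (PadicAlgCl p) (JointModel.Pt p)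
    (fun _ => PadicAlgCl p) Unit :=
  WittShift.datum (base Λ) (idx p)

/-- (H2) at a classical class: `ι(ϕw) + 1 = ι(w)` (E-t50's `orbitIdx_frobPerm`). [folklore] -/
theorem idx_step {w : JointModel.Pt p} (hw : 0 < JointModel.e p w) : idx p ((base Λ).frobY w) + 1 = idx p w := by
  show -JointModel.Witt.orbitIdx p (JointModel.Witt.frobPerm p w) + 1 = -JointModel.Witt.orbitIdx p w
  rw [JointModel.Witt.orbitIdx_frobPerm p hw]
  ring

/-- (H1) at a classical class: `η⁰_{ϕw}([x^p]⁰) = η⁰_w([x]⁰)`, i.e. `L_{ϕw}(x^p) = L_w(x)` (E-t50's `value_frobPerm` through `eval_X`). [folklore] -/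
theorem values_frob {w : JointModel.Pt p} (hw : 0 < JointModel.e p w) (x : PadicAlgCl p) :
    (base Λ).eta ((base Λ).frobY w) ((base Λ).teich (x ^ (base Λ).p)) = (base Λ).eta w ((base Λ).teich x) := by
  show MvPolynomial.eval (JointModel.Witt.value Λ (JointModel.frobPt p w)) (X (x ^ p)) =
    MvPolynomial.eval (JointModel.Witt.value Λ w) (X x)
  rw [eval_X, eval_X]
  exact JointModel.Witt.value_frobPerm Λ hw x

/-- **§10.13's transport at every classical class of the W6⁺ datum.** [folklore] -/
def transport {w : JointModel.Pt p} (hw : 0 < JointModel.e p w) : (datum Λ).FrobeniusTransport w :=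
  WittShift.transport (idx_step Λ hw) (values_frob Λ hw)

/-- Classical classes have positive exponent (E-t50's `e_pos_of_adm`; `classicalPts` is the base datum's, `WittShift.classicalPts_eq`). [folklore] -/
theorem e_pos_of_mem_classicalPts {w : JointModel.Pt p} (hw : w ∈ (datum Λ).classicalPts) : 0 < JointModel.e p w := by
  obtain ⟨a, ha0, ha1, rfl⟩ := hw
  have ha1' : ‖a‖ < 1 := by rwa [show (datum Λ).absF = Model.absOne p from rfl, Model.absOne_apply] at ha1
  exact JointModel.Witt.e_pos_of_adm ⟨norm_pos_iff.2 ha0, ha1'⟩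

/-- **W6⁺ PACKAGED** (parametric in the class lift `Λ`): at ONE datum — E-t2's `EtaPtTeich` ∧ bijective `ϕ_Y` ∧ the Witt law ∧ §10.13
transports on ALL of `classicalPts` ∧ none at the junk fixed class `pt 1` ∧ `KummerShift` ∧ `B^{φ=p} ≠ 0` ∧ at every classical class: «log
hits 1», p430819's (R-ϕ) horn (identity common target) and `scale(ϕw) = p·scale(w)`. [folklore] -/
theorem w6plus_package :
    (datum Λ).EtaPtTeich ∧ Function.Bijective (datum Λ).frobY ∧
      (∀ a, (datum Λ).frob ((datum Λ).teich a) = (datum Λ).teich (a ^ (datum Λ).p)) ∧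
      (∀ w ∈ (datum Λ).classicalPts, Nonempty ((datum Λ).FrobeniusTransport w)) ∧
      IsEmpty ((datum Λ).FrobeniusTransport ((datum Λ).pt 1)) ∧ (datum Λ).KummerShift ∧ (∃ b ∈ (datum Λ).Bphi, b ≠ 0) ∧
      (∀ w ∈ (datum Λ).classicalPts,
        (∃ b ∈ (datum Λ).Bphi, (datum Λ).eta ((datum Λ).frobY w) b = 1) ∧ ¬ (datum Λ).NoCommutingFieldIso w ∧
          ¬ PeriodRingDatum.NoInsertedIso (WittShift.idTarget (base Λ) (idx p) w) ∧
          PeriodRingDatum.LogShellStep (WittShift.idTarget (base Λ) (idx p) w) ∧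
          ¬ PeriodRingDatum.LogsCoincide (WittShift.idTarget (base Λ) (idx p) w) ∧
          (datum Λ).scale ((datum Λ).frobY w) = (datum Λ).p * (datum Λ).scale w) := by
  refine ⟨(WittShift.etaPtTeich_iff _ _).2 (JointModel.Witt.etaPtTeich Λ), JointModel.frobPt_bijective p, WittShift.frob_teich _ _,
    fun w hw => ⟨transport Λ (e_pos_of_mem_classicalPts Λ hw)⟩,
    (datum Λ).isEmpty_frobeniusTransport_pt_one (WittShift.frob_teich _ _), WittShift.kummerShift _ _,
    WittShift.exists_mem_Bphi_ne_zero _ _, fun w hw => ?_⟩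
  have he := e_pos_of_mem_classicalPts Λ hw
  exact ⟨WittShift.hone _ _ w, (WittShift.rphi_horn (idx_step Λ he) (values_frob Λ he)).1,
    (WittShift.rphi_horn (idx_step Λ he) (values_frob Λ he)).2.1, (WittShift.rphi_horn (idx_step Λ he) (values_frob Λ he)).2.2.1,
    (WittShift.rphi_horn (idx_step Λ he) (values_frob Λ he)).2.2.2, (WittShift.scale_frobY_and_absK (idx_step Λ he) (values_frob Λ he) 0).1⟩

variable (p) in
/-- A `ClassLift` from this seat's torsion-invariant surjection (p451035): `Λ(w) := invLift (w.out)` — norm-preserving by `norm_invLift`,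
onto because `invLift` is onto and constant on `μ_{p^∞}`-classes (`invLift_eq_of_pow_prime_pow_eq`). `private`: the PUBLIC inhabitant of
record is E-t50's `JointModel.Witt.invClassLift` (part 3, `Joshi/PrototypeWittModelLog.lean`, p452268 — the same six lines, plus an explicit
logarithmic lift for `p ≥ 3`); this copy only discharges the `∃` below without waiting on that olean. [folklore] -/
private def classLiftOfInvLift : JointModel.Witt.ClassLift p where
  toFun w := Model.invLift p w.out
  norm_apply w := Model.norm_invLift p _
  surjective ξ := by
    obtain ⟨x, hx⟩ := Model.invLift_surjective p ξ
    obtain ⟨n, hn⟩ := JointModel.rel_out_mk p x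
    exact ⟨JointModel.mk p x, by rw [← hx]; exact Model.invLift_eq_of_pow_prime_pow_eq p hn⟩

variable (p) in
/-- **W6⁺ IS NON-VACUOUS at every prime**: the package at the class lift `w ↦ invLift (w.out)` (p451035). [folklore] -/
theorem w6plus_nonvacuous :
    ∃ Λ : JointModel.Witt.ClassLift p,
      (datum Λ).EtaPtTeich ∧ Function.Bijective (datum Λ).frobY ∧
        (∀ a, (datum Λ).frob ((datum Λ).teich a) = (datum Λ).teich (a ^ (datum Λ).p)) ∧
        (∀ w ∈ (datum Λ).classicalPts, Nonempty ((datum Λ).FrobeniusTransport w)) ∧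
        IsEmpty ((datum Λ).FrobeniusTransport ((datum Λ).pt 1)) ∧ (datum Λ).KummerShift ∧ (∃ b ∈ (datum Λ).Bphi, b ≠ 0) :=
  ⟨classLiftOfInvLift p, (w6plus_package _).1, (w6plus_package _).2.1, (w6plus_package _).2.2.1, (w6plus_package _).2.2.2.1,
    (w6plus_package _).2.2.2.2.1, (w6plus_package _).2.2.2.2.2.1, (w6plus_package _).2.2.2.2.2.2.1⟩

end Summit.ABC.IUTFork.Joshi.WittShift.W6

end
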